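import Summits.QuantumFields.YangMills.Theorems.PoincareLipschitzLatticeSubunitProjection
import Summits.QuantumFields.YangMills.Theorems.PoincareLipschitzSobolevCellAverages
import Summits.QuantumFields.YangMills.Theorems.PoincareLipschitzSamplingCells
import Literature.Analysis.FunctionSpaces.SobolevTraceDensityProofs
import Literature.MathematicalPhysics.QuantumFieldTheory.Balaban1983to89.B4Eq19LatticeOperators
import Mathlib.MeasureTheory.Function.L2Space
import HarnessLib

/-!
# `PoincareLipschitzSobolevSamplingConsistency` — LINE 25 S2♭″ brick (Γ5-KNIT) «SOBOLEV SAMPLING CONSISTENCY: hΓ5 FROM Γ5b′ + Γ5-B + Γ5-C + Γ5-D»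
# (crux `BlockLipschitzL` stmt-QuantumFields-23533 ∕ `HistoryTailL` stmt-QuantumFields-19936, LINE 25 `compactness_transfer`; helper
# `--supports stmt-QuantumFields-23533 --as helper`, count-neutral)

Cell `ym3-torus` (YM ladder rung R3 = continuum SU(2) Yang–Mills on T³ — a RUNG, NOT the Clay problem: not d = 4, not infinite volume, not a
mass gap); width seat `ym3-torus-px5` (g8), pen of record for (Γ5-KNIT) (w7 g13 2026-08-29 13:00:37Z).  THEOREMS ONLY (0 `def`, 0 `sorry`, default
heartbeats).  DOOR FORM: the three rows (Γ5-B) px15 g6, (Γ5-C) w7 g13, (Γ5-D) w4 g15 are DISPLAYED HYPOTHESES in their pens' SIGNATURE-0 letters; the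
closed corollary (no hypotheses) is a three-line file once they land.

WHAT IS PROVED.  ★★★ `exists_unit_sample_of_sobolev (hB) (hC) (hD) : ⟨px3 g8's Γ-KNIT hypothesis `hΓ5`, VERBATIM⟩` — for a unit Sobolev map `V` on the
open cube `Q` with square-integrable weak gradient, scales `0 < s < s′ < 1` and `η > 0`: for all large `R` a UNIT lattice map `v : ℤ³ → S³` with
`R⁻¹·E_latt(v; Q_{⌊sR⌋}(0)) ≤ ∫_{Q_{s′}} dens(GV) + η` and `∫_{Q_s} ‖v(⌊Rx⌋) − V x‖² ≤ η`.  Knit recipe (w7 g13): `κ := min(½, η∕(8(I+1)))`, `r := √(1−κ)`,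
`a :=` the cell averages of `𝟙_Q·V` (norm `≤ 1` everywhere), `v :=` ✓p719912 `exists_unit_of_subunit` at `T := (box 0 ⌊sR⌋) ×ˢ univ`; good–good bonds
`‖δv‖² ≤ ‖δa‖²∕(1−κ)`, bad bonds `≤ 36K(1−κ)⁻¹·Σ_bad‖δa‖²` = (Γ5-C); `R⁻¹Σ_T‖δa‖² ≤ ∫_{Q_{s′}}dens` = (Γ5-B); the `L²` clause = (Γ5-D).
PROOF.  WLOG `V ↦ V′ := 𝟙_Q•V` (lit ✓`SobolevApprox.hasWeakFDerivOn_congr`; every conclusion reads `V` on `Q_s ⊆ Q` only), so the cell averages have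
norm `≤ 1` on ALL of `ℤ³` (px15 ✓`norm_smul_setIntegral_cell_le_one`); `T = good ⊔ bad` by `Finset.sum_filter_add_sum_filter_not`; Γ5b′'s bad filter
`¬(r ≤ ‖a y‖ ∧ r ≤ ‖a y′‖)` is (Γ5-C)'s `‖a y‖² < 1−κ ∨ ‖a y′‖² < 1−κ` by `Finset.filter_congr`; `(1−κ)⁻¹ ≤ 1 + 2κ` (`κ ≤ ½`); `ε_C := η∕(4(C+1))`,
`ε_D := η`, `R₀ := max (max R_C R_D) (⌈2∕(s′−s)⌉₊ + 1)` (so `(⌊sR⌋+2)∕R ≤ s′` for (Γ5-B)).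
HONEST SCOPE.  A composition; (Γ5-B∕C∕D), S2♭″, S1″, `hImproveCoreFlat`, `BlockLipschitzL`, `HistoryTailL` are NOT proved here.  YM₃ on T³ is rung R3,
not Clay; the YM mass gap is NOT proved; no summit statement is proved here.

References: S. Luckhaus, Indiana Univ. Math. J. 37 (1988) 349–367; R. Hardt, D. Kinderlehrer, F.-H. Lin, Comm. Math. Phys. 105 (1986) 547–570
[HardtKinderlehrerLin1986]; R. Alicandro, M. Cicalese, Arch. Ration. Mech. Anal. 192 (2009) 501–536 [AlicandroCicalese2008].
-/

set_option autoImplicit false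

noncomputable section

open MeasureTheory Filter Topology
open scoped RealInnerProductSpace ENNReal BigOperators

namespace Summit.QuantumFields.YangMills.Theorems.PoincareLipschitzSobolevSamplingConsistency

open Literature.MathematicalPhysics.QuantumFieldTheory.Balaban1983to89
open B4Eq19LatticeOperators (Zd box unitVec mem_box)
open Literature.Analysis.FunctionSpaces (HasWeakFDerivOn)
open Literature.Analysis.FunctionSpaces.SobolevApprox (hasWeakFDerivOn_congr)
open Summit.QuantumFields.YangMills.Theorems.PoincareLipschitzLatticeSubunitProjection (exists_unit_of_subunit)
open Summit.QuantumFields.YangMills.Theorems.PoincareLipschitzSobolevCellAverages (norm_smul_setIntegral_cell_le_one)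
open Summit.QuantumFields.YangMills.Theorems.PoincareLipschitzSamplingCells (isOpen_absCube)

/-- ★★★ **(Γ5-KNIT) SOBOLEV SAMPLING CONSISTENCY — `hΓ5` OF THE Γ-KNIT, FROM THE ROWS.**  Hypotheses (displayed until they land):
`hB` = (Γ5-B) the summed sharp translation row (px15 g6; with the bound `‖V‖ ≤ 1` on `Q`, px15's (α) 13:15Z), `hC` = (Γ5-C) «bad cells are few and carry little energy» (w7 g13 13:00:37Z interface
VERBATIM), `hD` = (Γ5-D) the `L²` row (w4 g15; w7's 12:59:37Z shape).  Conclusion = px3 g8's `hΓ5` (KNIT SIGNATURE-0 958401517cca6ce5) VERBATIM.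
[folklore] [cite: Luckhaus1988, Lemma 1; HardtKinderlehrerLin1986, §2; AlicandroCicalese2008, §2] -/
theorem exists_unit_sample_of_sobolev
    (hB : ∀ (hQ : IsOpen {x : EuclideanSpace ℝ (Fin 3) | ∀ i : Fin 3, |x i| < 1})
      (V : EuclideanSpace ℝ (Fin 3) → EuclideanSpace ℝ (Fin 4)) (GV : EuclideanSpace ℝ (Fin 3) → (EuclideanSpace ℝ (Fin 3) →L[ℝ] EuclideanSpace ℝ (Fin 4))),
      HasWeakFDerivOn ⟨{x : EuclideanSpace ℝ (Fin 3) | ∀ i : Fin 3, |x i| < 1}, hQ⟩ volume V GV →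
      IntegrableOn (fun x => ∑ i : Fin 3, ‖GV x (EuclideanSpace.single i (1:ℝ))‖ ^ 2) {x : EuclideanSpace ℝ (Fin 3) | ∀ i : Fin 3, |x i| < 1} volume →
      (∀ x : EuclideanSpace ℝ (Fin 3), (∀ i : Fin 3, |x i| < 1) → ‖V x‖ ≤ 1) →
      ∀ (s' : ℝ), s' < 1 → ∀ (R : ℕ) (n : ℤ), 0 < R → ((n : ℝ) + 2) / R ≤ s' →
      ∀ (a : Zd 3 → EuclideanSpace ℝ (Fin 4)),
        (∀ y, a y = ((R : ℝ) ^ 3) • ∫ x in {x : EuclideanSpace ℝ (Fin 3) | ∀ i, (y i : ℝ) / R < x i ∧ x i < ((y i : ℝ) + 1) / R}, V x) →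
        (R : ℝ)⁻¹ * ∑ y ∈ box (0 : Zd 3) n, ∑ μ : Fin 3, ‖a (y + unitVec μ) - a y‖ ^ 2 ≤
          ∫ x in {x : EuclideanSpace ℝ (Fin 3) | ∀ i : Fin 3, |x i| < s'}, ∑ i : Fin 3, ‖GV x (EuclideanSpace.single i (1:ℝ))‖ ^ 2)
    (hC : ∀ (hQ : IsOpen {x : EuclideanSpace ℝ (Fin 3) | ∀ i : Fin 3, |x i| < 1})
      (V : EuclideanSpace ℝ (Fin 3) → EuclideanSpace ℝ (Fin 4)) (GV : EuclideanSpace ℝ (Fin 3) → (EuclideanSpace ℝ (Fin 3) →L[ℝ] EuclideanSpace ℝ (Fin 4))),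
      HasWeakFDerivOn ⟨{x : EuclideanSpace ℝ (Fin 3) | ∀ i : Fin 3, |x i| < 1}, hQ⟩ volume V GV →
      (∀ x : EuclideanSpace ℝ (Fin 3), (∀ i : Fin 3, |x i| < 1) → ‖V x‖ = 1) →
      IntegrableOn (fun x => ∑ i : Fin 3, ‖GV x (EuclideanSpace.single i (1:ℝ))‖ ^ 2) {x : EuclideanSpace ℝ (Fin 3) | ∀ i : Fin 3, |x i| < 1} volume →
      ∀ (κ s ε : ℝ), 0 < κ → κ < 1 → 0 < s → s < 1 → 0 < ε → ∃ R₀ : ℕ, ∀ R : ℕ, R₀ ≤ R →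
      ∀ (a : Zd 3 → EuclideanSpace ℝ (Fin 4)),
        (∀ y, a y = ((R : ℝ) ^ 3) • ∫ x in {x : EuclideanSpace ℝ (Fin 3) | ∀ i, (y i : ℝ) / R < x i ∧ x i < ((y i : ℝ) + 1) / R}, V x) →
        (R : ℝ)⁻¹ * (∑ e ∈ (box (0 : Zd 3) ⌊s * R⌋ ×ˢ (Finset.univ : Finset (Fin 3))) with
            (‖a e.1‖ ^ 2 < 1 - κ ∨ ‖a (e.1 + unitVec e.2)‖ ^ 2 < 1 - κ), ‖a (e.1 + unitVec e.2) - a e.1‖ ^ 2) ≤ ε ∧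
        ((R : ℝ)⁻¹) ^ 3 * (((box (0 : Zd 3) (⌊s * R⌋ + 1)).filter (fun y => ‖a y‖ ^ 2 < 1 - κ)).card : ℝ) ≤ ε)
    (hD : ∀ (hQ : IsOpen {x : EuclideanSpace ℝ (Fin 3) | ∀ i : Fin 3, |x i| < 1})
      (V : EuclideanSpace ℝ (Fin 3) → EuclideanSpace ℝ (Fin 4)) (GV : EuclideanSpace ℝ (Fin 3) → (EuclideanSpace ℝ (Fin 3) →L[ℝ] EuclideanSpace ℝ (Fin 4))),
      HasWeakFDerivOn ⟨{x : EuclideanSpace ℝ (Fin 3) | ∀ i : Fin 3, |x i| < 1}, hQ⟩ volume V GV →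
      (∀ x : EuclideanSpace ℝ (Fin 3), (∀ i : Fin 3, |x i| < 1) → ‖V x‖ = 1) →
      IntegrableOn (fun x => ∑ i : Fin 3, ‖GV x (EuclideanSpace.single i (1:ℝ))‖ ^ 2) {x : EuclideanSpace ℝ (Fin 3) | ∀ i : Fin 3, |x i| < 1} volume →
      ∀ (κ s ε : ℝ), 0 < κ → κ < 1 → 0 < s → s < 1 → 0 < ε → ∃ R₀ : ℕ, ∀ R : ℕ, R₀ ≤ R →
      ∀ (a : Zd 3 → EuclideanSpace ℝ (Fin 4)),
        (∀ y, a y = ((R : ℝ) ^ 3) • ∫ x in {x : EuclideanSpace ℝ (Fin 3) | ∀ i, (y i : ℝ) / R < x i ∧ x i < ((y i : ℝ) + 1) / R}, V x) →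
        ∀ (v : Zd 3 → EuclideanSpace ℝ (Fin 4)), (∀ y, ‖v y‖ = 1) →
        (∀ y, Real.sqrt (1 - κ) ≤ ‖a y‖ → v y = ‖a y‖⁻¹ • a y) →
        ∫ x in {x : EuclideanSpace ℝ (Fin 3) | ∀ i : Fin 3, |x i| < s}, ‖v (fun i => ⌊(R : ℝ) * x i⌋) - V x‖ ^ 2 ≤ ε) :
    ∀ (hQ : IsOpen {x : EuclideanSpace ℝ (Fin 3) | ∀ i : Fin 3, |x i| < 1})
      (V : EuclideanSpace ℝ (Fin 3) → EuclideanSpace ℝ (Fin 4)) (GV : EuclideanSpace ℝ (Fin 3) → (EuclideanSpace ℝ (Fin 3) →L[ℝ] EuclideanSpace ℝ (Fin 4))),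
      HasWeakFDerivOn ⟨{x : EuclideanSpace ℝ (Fin 3) | ∀ i : Fin 3, |x i| < 1}, hQ⟩ volume V GV →
      (∀ x : EuclideanSpace ℝ (Fin 3), (∀ i : Fin 3, |x i| < 1) → ‖V x‖ = 1) →
      IntegrableOn (fun x => ∑ i : Fin 3, ‖GV x (EuclideanSpace.single i (1:ℝ))‖ ^ 2) {x : EuclideanSpace ℝ (Fin 3) | ∀ i : Fin 3, |x i| < 1} volume →
      ∀ (s s' η : ℝ), 0 < s → s < s' → s' < 1 → 0 < η → ∃ R₀ : ℕ, ∀ R : ℕ, R₀ ≤ R →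
        ∃ v : Zd 3 → EuclideanSpace ℝ (Fin 4), (∀ y, ‖v y‖ = 1) ∧
          (R : ℝ)⁻¹ * ∑ y ∈ box (0 : Zd 3) ⌊s * R⌋, ∑ μ : Fin 3, ‖v (y + unitVec μ) - v y‖ ^ 2 ≤
            (∫ x in {x : EuclideanSpace ℝ (Fin 3) | ∀ i : Fin 3, |x i| < s'}, ∑ i : Fin 3, ‖GV x (EuclideanSpace.single i (1:ℝ))‖ ^ 2) + η ∧
          ∫ x in {x : EuclideanSpace ℝ (Fin 3) | ∀ i : Fin 3, |x i| < s}, ‖v (fun i => ⌊(R : ℝ) * x i⌋) - V x‖ ^ 2 ≤ η := by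
  intro hQ V GV hW hunit hdens s s' η hs hss' hs'1 hη
  classical
  have hs' : 0 < s' := hs.trans hss'
  have hs1 : s < 1 := hss'.trans hs'1
  -- the Γ5b′ constant
  obtain ⟨C, hC0, h5b⟩ := exists_unit_of_subunit
  -- total Dirichlet integral and the threshold `κ`
  obtain ⟨I, hI⟩ : ∃ I : ℝ, I = ∫ x in {x : EuclideanSpace ℝ (Fin 3) | ∀ i : Fin 3, |x i| < 1},
      ∑ i : Fin 3, ‖GV x (EuclideanSpace.single i (1:ℝ))‖ ^ 2 := ⟨_, rfl⟩
  have hI0 : 0 ≤ I := by rw [hI]; exact integral_nonneg fun x => Finset.sum_nonneg fun i _ => sq_nonneg _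
  obtain ⟨κ, hκ⟩ : ∃ κ : ℝ, κ = min (1 / 2) (η / (8 * (I + 1))) := ⟨_, rfl⟩
  have hκ0 : 0 < κ := by rw [hκ]; exact lt_min (by norm_num) (by positivity)
  have hκhalf : κ ≤ 1 / 2 := by rw [hκ]; exact min_le_left _ _
  have hκ1 : κ < 1 := by linarith only [hκhalf]
  have hκI : κ ≤ η / (8 * (I + 1)) := by rw [hκ]; exact min_le_right _ _
  have hκI' : 2 * κ * I ≤ η / 4 := by
    have h8 : 0 < 8 * (I + 1) := by positivity
    have h1 : κ * (8 * (I + 1)) ≤ η := by rwa [le_div_iff₀ h8] at hκI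
    have h2 : 0 ≤ κ := hκ0.le
    nlinarith [mul_nonneg h2 hI0, h1, h2]
  -- the good radius `r = √(1 − κ)`
  obtain ⟨r, hr⟩ : ∃ r : ℝ, r = Real.sqrt (1 - κ) := ⟨_, rfl⟩
  have hr2 : r ^ 2 = 1 - κ := by rw [hr, Real.sq_sqrt (by linarith only [hκ1])]
  have hr0 : 0 < r := by rw [hr]; exact Real.sqrt_pos.2 (by linarith only [hκ1])
  have hrhalf : 1 / 2 ≤ r := by
    rw [hr, Real.le_sqrt (by norm_num) (by linarith only [hκ1])]; linarith only [hκhalf]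
  have hr1 : r ≤ 1 := by rw [hr, Real.sqrt_le_one]; linarith only [hκ0]
  -- the modified map `V′ := 𝟙_Q • V`
  obtain ⟨V', hV'⟩ : ∃ V' : EuclideanSpace ℝ (Fin 3) → EuclideanSpace ℝ (Fin 4),
      V' = Set.indicator {x : EuclideanSpace ℝ (Fin 3) | ∀ i : Fin 3, |x i| < 1} V := ⟨_, rfl⟩
  have hVeq : Set.EqOn V' V {x : EuclideanSpace ℝ (Fin 3) | ∀ i : Fin 3, |x i| < 1} := fun x hx => by
    rw [hV', Set.indicator_of_mem hx]
  have hW' : HasWeakFDerivOn ⟨{x : EuclideanSpace ℝ (Fin 3) | ∀ i : Fin 3, |x i| < 1}, hQ⟩ volume V' GV :=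
    hasWeakFDerivOn_congr hW hVeq (fun _ _ => rfl)
  have hunit' : ∀ x : EuclideanSpace ℝ (Fin 3), (∀ i : Fin 3, |x i| < 1) → ‖V' x‖ = 1 := fun x hx => by
    rw [hVeq hx]; exact hunit x hx
  have hV'le : ∀ x, ‖V' x‖ ≤ 1 := fun x => by
    by_cases hx : x ∈ {x : EuclideanSpace ℝ (Fin 3) | ∀ i : Fin 3, |x i| < 1}
    · rw [hVeq hx, hunit x hx]
    · rw [hV', Set.indicator_of_notMem hx, norm_zero]; exact zero_le_one
  -- the three rows at `V′`
  have hεC : 0 < η / (4 * (C + 1)) := by positivity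
  obtain ⟨RC, hRC⟩ := hC hQ V' GV hW' hunit' hdens κ s (η / (4 * (C + 1))) hκ0 hκ1 hs hs1 hεC
  obtain ⟨RD, hRD⟩ := hD hQ V' GV hW' hunit' hdens κ s η hκ0 hκ1 hs hs1 hη
  -- the scale threshold
  refine ⟨max (max RC RD) (⌈2 / (s' - s)⌉₊ + 1), fun R hR => ?_⟩
  have hRC' : RC ≤ R := le_trans (le_trans (le_max_left _ _) (le_max_left _ _)) hR
  have hRD' : RD ≤ R := le_trans (le_trans (le_max_right _ _) (le_max_left _ _)) hR
  have hRB : ⌈2 / (s' - s)⌉₊ + 1 ≤ R := le_trans (le_max_right _ _) hR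
  have hRpos : 0 < R := lt_of_lt_of_le (Nat.succ_pos _) hRB
  have hRr : (0 : ℝ) < (R : ℝ) := Nat.cast_pos.2 hRpos
  have hss : 0 < s' - s := by linarith only [hss']
  have hside : ((⌊s * (R : ℝ)⌋ : ℝ) + 2) / (R : ℝ) ≤ s' := by
    rw [div_le_iff₀ hRr]
    have h1 : ((⌊s * (R : ℝ)⌋ : ℤ) : ℝ) ≤ s * R := Int.floor_le _
    have h2 : (2 / (s' - s) : ℝ) ≤ ⌈2 / (s' - s)⌉₊ := Nat.le_ceil _
    have h3 : ((⌈2 / (s' - s)⌉₊ : ℕ) : ℝ) + 1 ≤ (R : ℝ) := by exact_mod_cast hRB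
    have h4 : 2 ≤ (s' - s) * R := by
      have : 2 / (s' - s) ≤ (R : ℝ) := by linarith only [h2, h3]
      rwa [div_le_iff₀ hss, mul_comm] at this
    nlinarith [h1, h4]
  -- the cell averages of `V′`
  obtain ⟨a, ha⟩ : ∃ a : Zd 3 → EuclideanSpace ℝ (Fin 4), ∀ y, a y = ((R : ℝ) ^ 3) •
      ∫ x in {x : EuclideanSpace ℝ (Fin 3) | ∀ i, (y i : ℝ) / R < x i ∧ x i < ((y i : ℝ) + 1) / R}, V' x :=
    ⟨_, fun _ => rfl⟩
  have ha1 : ∀ y, ‖a y‖ ≤ 1 := fun y => by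
    rw [ha]; exact norm_smul_setIntegral_cell_le_one hRpos y V' (ae_of_all _ fun x => hV'le x)
  -- Γ5b′ on the bonds of the sampled box
  obtain ⟨v, hv1, hvgood, hgg, hbad⟩ :=
    h5b r hrhalf hr1 a ha1 (box (0 : Zd 3) ⌊s * (R : ℝ)⌋ ×ˢ (Finset.univ : Finset (Fin 3)))
  refine ⟨v, hv1, ?_, ?_⟩
  · -- ENERGY
    -- row (Γ5-B): `R⁻¹ Σ_T ‖δa‖² ≤ ∫_{Q_{s′}} dens`
    have hBR := hB hQ V' GV hW' hdens (fun x _ => hV'le x) s' hs'1 R ⌊s * (R : ℝ)⌋ hRpos hside a ha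
    -- row (Γ5-C): bad bonds
    have hCR := (hRC R hRC' a ha).1
    -- `J := ∫_{Q_{s′}} dens ≤ I`
    have hJ0 : 0 ≤ ∫ x in {x : EuclideanSpace ℝ (Fin 3) | ∀ i : Fin 3, |x i| < s'},
        ∑ i : Fin 3, ‖GV x (EuclideanSpace.single i (1:ℝ))‖ ^ 2 :=
      integral_nonneg fun x => Finset.sum_nonneg fun i _ => sq_nonneg _
    have hJI : ∫ x in {x : EuclideanSpace ℝ (Fin 3) | ∀ i : Fin 3, |x i| < s'},
        ∑ i : Fin 3, ‖GV x (EuclideanSpace.single i (1:ℝ))‖ ^ 2 ≤ I := by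
      rw [hI]
      refine setIntegral_mono_set hdens (ae_of_all _ fun x => Finset.sum_nonneg fun i _ => sq_nonneg _)
        (ae_of_all _ ?_)
      intro x hx i
      exact lt_trans (hx i) hs'1
    -- split the bond set into good–good bonds and the rest
    have hsplit := Finset.sum_filter_add_sum_filter_not (box (0 : Zd 3) ⌊s * (R : ℝ)⌋ ×ˢ (Finset.univ : Finset (Fin 3)))
      (fun e => r ≤ ‖a e.1‖ ∧ r ≤ ‖a (e.1 + unitVec e.2)‖) (fun e => ‖v (e.1 + unitVec e.2) - v e.1‖ ^ 2)
    -- good–good bonds: `‖δv‖² ≤ ‖δa‖² ∕ (1 − κ)`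
    have hgood : ∑ e ∈ (box (0 : Zd 3) ⌊s * (R : ℝ)⌋ ×ˢ (Finset.univ : Finset (Fin 3))) with
          (r ≤ ‖a e.1‖ ∧ r ≤ ‖a (e.1 + unitVec e.2)‖), ‖v (e.1 + unitVec e.2) - v e.1‖ ^ 2
        ≤ (1 - κ)⁻¹ * ∑ e ∈ box (0 : Zd 3) ⌊s * (R : ℝ)⌋ ×ˢ (Finset.univ : Finset (Fin 3)),
            ‖a (e.1 + unitVec e.2) - a e.1‖ ^ 2 := by
      calc ∑ e ∈ (box (0 : Zd 3) ⌊s * (R : ℝ)⌋ ×ˢ (Finset.univ : Finset (Fin 3))) with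
            (r ≤ ‖a e.1‖ ∧ r ≤ ‖a (e.1 + unitVec e.2)‖), ‖v (e.1 + unitVec e.2) - v e.1‖ ^ 2
          ≤ ∑ e ∈ (box (0 : Zd 3) ⌊s * (R : ℝ)⌋ ×ˢ (Finset.univ : Finset (Fin 3))) with
            (r ≤ ‖a e.1‖ ∧ r ≤ ‖a (e.1 + unitVec e.2)‖), (1 - κ)⁻¹ * ‖a (e.1 + unitVec e.2) - a e.1‖ ^ 2 := by
            refine Finset.sum_le_sum fun e he => ?_
            obtain ⟨h1, h2⟩ := (Finset.mem_filter.1 he).2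
            have hprod : 1 - κ ≤ ‖a e.1‖ * ‖a (e.1 + unitVec e.2)‖ := by
              rw [← hr2, sq]; exact mul_le_mul h1 h2 hr0.le (norm_nonneg _)
            have hκ' : 0 < 1 - κ := by linarith only [hκ1]
            calc ‖v (e.1 + unitVec e.2) - v e.1‖ ^ 2
                ≤ ‖a (e.1 + unitVec e.2) - a e.1‖ ^ 2 / (‖a e.1‖ * ‖a (e.1 + unitVec e.2)‖) := hgg e.1 e.2 h1 h2
              _ ≤ ‖a (e.1 + unitVec e.2) - a e.1‖ ^ 2 / (1 - κ) :=
                  div_le_div_of_nonneg_left (sq_nonneg _) hκ' hprod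
              _ = (1 - κ)⁻¹ * ‖a (e.1 + unitVec e.2) - a e.1‖ ^ 2 := by rw [div_eq_inv_mul]
        _ = (1 - κ)⁻¹ * ∑ e ∈ (box (0 : Zd 3) ⌊s * (R : ℝ)⌋ ×ˢ (Finset.univ : Finset (Fin 3))) with
            (r ≤ ‖a e.1‖ ∧ r ≤ ‖a (e.1 + unitVec e.2)‖), ‖a (e.1 + unitVec e.2) - a e.1‖ ^ 2 := by
            rw [Finset.mul_sum]
        _ ≤ (1 - κ)⁻¹ * ∑ e ∈ box (0 : Zd 3) ⌊s * (R : ℝ)⌋ ×ˢ (Finset.univ : Finset (Fin 3)),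
            ‖a (e.1 + unitVec e.2) - a e.1‖ ^ 2 := by
            refine mul_le_mul_of_nonneg_left ?_ (inv_nonneg.2 (by linarith only [hκ1]))
            exact Finset.sum_le_sum_of_subset_of_nonneg (Finset.filter_subset _ _) fun e _ _ => sq_nonneg _
    -- the other bonds: Γ5b′'s averaging bound, then (Γ5-C)
    have hfilt : ((box (0 : Zd 3) ⌊s * (R : ℝ)⌋ ×ˢ (Finset.univ : Finset (Fin 3))).filter
          (fun e => ¬ (r ≤ ‖a e.1‖ ∧ r ≤ ‖a (e.1 + unitVec e.2)‖)))
        = ((box (0 : Zd 3) ⌊s * (R : ℝ)⌋ ×ˢ (Finset.univ : Finset (Fin 3))).filter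
          (fun e => ‖a e.1‖ ^ 2 < 1 - κ ∨ ‖a (e.1 + unitVec e.2)‖ ^ 2 < 1 - κ)) := by
      refine Finset.filter_congr fun e _ => ?_
      have key : ∀ w : EuclideanSpace ℝ (Fin 4), ¬ (r ≤ ‖w‖) ↔ ‖w‖ ^ 2 < 1 - κ := by
        intro w
        rw [not_le, ← hr2]
        constructor
        · intro h; exact pow_lt_pow_left₀ h (norm_nonneg _) two_ne_zero
        · intro h; exact lt_of_pow_lt_pow_left₀ 2 hr0.le h
      rw [not_and_or, key, key]
    have hbad' : ∑ e ∈ (box (0 : Zd 3) ⌊s * (R : ℝ)⌋ ×ˢ (Finset.univ : Finset (Fin 3))) with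
          (¬ (r ≤ ‖a e.1‖ ∧ r ≤ ‖a (e.1 + unitVec e.2)‖)), ‖v (e.1 + unitVec e.2) - v e.1‖ ^ 2
        ≤ C * (1 - κ)⁻¹ * ∑ e ∈ (box (0 : Zd 3) ⌊s * (R : ℝ)⌋ ×ˢ (Finset.univ : Finset (Fin 3))) with
            (‖a e.1‖ ^ 2 < 1 - κ ∨ ‖a (e.1 + unitVec e.2)‖ ^ 2 < 1 - κ), ‖a (e.1 + unitVec e.2) - a e.1‖ ^ 2 := by
      have hrinv : (r⁻¹) ^ 2 = (1 - κ)⁻¹ := by rw [inv_pow, hr2]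
      have h2 : ∑ e ∈ (box (0 : Zd 3) ⌊s * (R : ℝ)⌋ ×ˢ (Finset.univ : Finset (Fin 3))) with
            (¬ (r ≤ ‖a e.1‖ ∧ r ≤ ‖a (e.1 + unitVec e.2)‖)), ‖a (e.1 + unitVec e.2) - a e.1‖ ^ 2
          = ∑ e ∈ (box (0 : Zd 3) ⌊s * (R : ℝ)⌋ ×ˢ (Finset.univ : Finset (Fin 3))) with
            (‖a e.1‖ ^ 2 < 1 - κ ∨ ‖a (e.1 + unitVec e.2)‖ ^ 2 < 1 - κ), ‖a (e.1 + unitVec e.2) - a e.1‖ ^ 2 := by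
        rw [hfilt]
      calc ∑ e ∈ (box (0 : Zd 3) ⌊s * (R : ℝ)⌋ ×ˢ (Finset.univ : Finset (Fin 3))) with
            (¬ (r ≤ ‖a e.1‖ ∧ r ≤ ‖a (e.1 + unitVec e.2)‖)), ‖v (e.1 + unitVec e.2) - v e.1‖ ^ 2
          ≤ C * (r⁻¹) ^ 2 * ∑ e ∈ (box (0 : Zd 3) ⌊s * (R : ℝ)⌋ ×ˢ (Finset.univ : Finset (Fin 3))) with
            (¬ (r ≤ ‖a e.1‖ ∧ r ≤ ‖a (e.1 + unitVec e.2)‖)), ‖a (e.1 + unitVec e.2) - a e.1‖ ^ 2 := hbad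
        _ = C * (1 - κ)⁻¹ * ∑ e ∈ (box (0 : Zd 3) ⌊s * (R : ℝ)⌋ ×ˢ (Finset.univ : Finset (Fin 3))) with
            (‖a e.1‖ ^ 2 < 1 - κ ∨ ‖a (e.1 + unitVec e.2)‖ ^ 2 < 1 - κ), ‖a (e.1 + unitVec e.2) - a e.1‖ ^ 2 := by
            rw [h2, hrinv]
    -- assemble the energy bound
    have hκ' : 0 < 1 - κ := by linarith only [hκ1]
    have hinvκ : (1 - κ)⁻¹ ≤ 1 + 2 * κ := by
      rw [inv_le_iff_one_le_mul₀ hκ', show (1 + 2 * κ) * (1 - κ) = 1 + κ * (1 - 2 * κ) by ring]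
      have : 0 ≤ κ * (1 - 2 * κ) := mul_nonneg hκ0.le (by linarith only [hκhalf])
      linarith only [this]
    have hinvκ2 : (1 - κ)⁻¹ ≤ 2 := by linarith only [hinvκ, hκhalf]
    -- name the sums
    obtain ⟨SA, hSA⟩ : ∃ SA : ℝ, SA = ∑ e ∈ box (0 : Zd 3) ⌊s * (R : ℝ)⌋ ×ˢ (Finset.univ : Finset (Fin 3)),
        ‖a (e.1 + unitVec e.2) - a e.1‖ ^ 2 := ⟨_, rfl⟩
    obtain ⟨SB, hSB⟩ : ∃ SB : ℝ, SB = ∑ e ∈ (box (0 : Zd 3) ⌊s * (R : ℝ)⌋ ×ˢ (Finset.univ : Finset (Fin 3))) with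
        (‖a e.1‖ ^ 2 < 1 - κ ∨ ‖a (e.1 + unitVec e.2)‖ ^ 2 < 1 - κ), ‖a (e.1 + unitVec e.2) - a e.1‖ ^ 2 := ⟨_, rfl⟩
    obtain ⟨J, hJ⟩ : ∃ J : ℝ, J = ∫ x in {x : EuclideanSpace ℝ (Fin 3) | ∀ i : Fin 3, |x i| < s'},
        ∑ i : Fin 3, ‖GV x (EuclideanSpace.single i (1:ℝ))‖ ^ 2 := ⟨_, rfl⟩
    rw [← hJ] at hBR hJ0 hJI ⊢
    rw [← hSB] at hCR hbad'
    rw [← hSA] at hgood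
    have hSA0 : 0 ≤ SA := by rw [hSA]; exact Finset.sum_nonneg fun e _ => sq_nonneg _
    have hSB0 : 0 ≤ SB := by rw [hSB]; exact Finset.sum_nonneg fun e _ => sq_nonneg _
    -- `R⁻¹ Σ_T ‖δa‖² ≤ J` in product form
    have hprodA : ∑ e ∈ box (0 : Zd 3) ⌊s * (R : ℝ)⌋ ×ˢ (Finset.univ : Finset (Fin 3)), ‖a (e.1 + unitVec e.2) - a e.1‖ ^ 2
        = ∑ y ∈ box (0 : Zd 3) ⌊s * (R : ℝ)⌋, ∑ μ : Fin 3, ‖a (y + unitVec μ) - a y‖ ^ 2 := by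
      rw [Finset.sum_product]
    have hBR' : (R : ℝ)⁻¹ * SA ≤ J := by
      rw [hSA, hprodA]
      exact hBR
    -- the lattice energy of `v` in product form
    have hprodV : ∑ e ∈ box (0 : Zd 3) ⌊s * (R : ℝ)⌋ ×ˢ (Finset.univ : Finset (Fin 3)), ‖v (e.1 + unitVec e.2) - v e.1‖ ^ 2
        = ∑ y ∈ box (0 : Zd 3) ⌊s * (R : ℝ)⌋, ∑ μ : Fin 3, ‖v (y + unitVec μ) - v y‖ ^ 2 := by
      rw [Finset.sum_product]
    rw [← hprodV, ← hsplit]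
    have htot : ∑ e ∈ (box (0 : Zd 3) ⌊s * (R : ℝ)⌋ ×ˢ (Finset.univ : Finset (Fin 3))) with
          (r ≤ ‖a e.1‖ ∧ r ≤ ‖a (e.1 + unitVec e.2)‖), ‖v (e.1 + unitVec e.2) - v e.1‖ ^ 2
        + ∑ e ∈ (box (0 : Zd 3) ⌊s * (R : ℝ)⌋ ×ˢ (Finset.univ : Finset (Fin 3))) with
          (¬ (r ≤ ‖a e.1‖ ∧ r ≤ ‖a (e.1 + unitVec e.2)‖)), ‖v (e.1 + unitVec e.2) - v e.1‖ ^ 2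
        ≤ (1 - κ)⁻¹ * SA + C * (1 - κ)⁻¹ * SB := add_le_add hgood hbad'
    have hR0 : 0 ≤ (R : ℝ)⁻¹ := inv_nonneg.2 hRr.le
    have step1 : (1 - κ)⁻¹ * ((R : ℝ)⁻¹ * SA) ≤ (1 - κ)⁻¹ * J :=
      mul_le_mul_of_nonneg_left hBR' (inv_nonneg.2 hκ'.le)
    have step2 : C * (1 - κ)⁻¹ * ((R : ℝ)⁻¹ * SB) ≤ C * (1 - κ)⁻¹ * (η / (4 * (C + 1))) :=
      mul_le_mul_of_nonneg_left hCR (mul_nonneg hC0 (inv_nonneg.2 hκ'.le))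
    have step3 : (1 - κ)⁻¹ * J ≤ (1 + 2 * κ) * J := mul_le_mul_of_nonneg_right hinvκ hJ0
    have step4 : C * (1 - κ)⁻¹ * (η / (4 * (C + 1))) ≤ C * 2 * (η / (4 * (C + 1))) :=
      mul_le_mul_of_nonneg_right (mul_le_mul_of_nonneg_left hinvκ2 hC0) hεC.le
    have step5 : C * 2 * (η / (4 * (C + 1))) ≤ η / 2 := by
      have hC1 : 0 < 4 * (C + 1) := by positivity
      rw [show C * 2 * (η / (4 * (C + 1))) = (2 * C * η) / (4 * (C + 1)) by ring, div_le_iff₀ hC1,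
        show η / 2 * (4 * (C + 1)) = 2 * C * η + 2 * η by ring]
      linarith only [hη]
    have h2κ : 0 ≤ 2 * κ := mul_nonneg zero_le_two hκ0.le
    have step6 : 2 * κ * J ≤ η / 4 := le_trans (mul_le_mul_of_nonneg_left hJI h2κ) hκI'
    have e1 : (1 + 2 * κ) * J = J + 2 * κ * J := by ring
    calc (R : ℝ)⁻¹ * (∑ e ∈ (box (0 : Zd 3) ⌊s * (R : ℝ)⌋ ×ˢ (Finset.univ : Finset (Fin 3))) with
            (r ≤ ‖a e.1‖ ∧ r ≤ ‖a (e.1 + unitVec e.2)‖), ‖v (e.1 + unitVec e.2) - v e.1‖ ^ 2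
          + ∑ e ∈ (box (0 : Zd 3) ⌊s * (R : ℝ)⌋ ×ˢ (Finset.univ : Finset (Fin 3))) with
            (¬ (r ≤ ‖a e.1‖ ∧ r ≤ ‖a (e.1 + unitVec e.2)‖)), ‖v (e.1 + unitVec e.2) - v e.1‖ ^ 2)
        ≤ (R : ℝ)⁻¹ * ((1 - κ)⁻¹ * SA + C * (1 - κ)⁻¹ * SB) := mul_le_mul_of_nonneg_left htot hR0
      _ = (1 - κ)⁻¹ * ((R : ℝ)⁻¹ * SA) + C * (1 - κ)⁻¹ * ((R : ℝ)⁻¹ * SB) := by ring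
      _ ≤ (1 + 2 * κ) * J + η / 2 := by linarith only [step1, step2, step3, step4, step5]
      _ = J + 2 * κ * J + η / 2 := by rw [e1]
      _ ≤ J + η := by linarith only [step6, hη]
  · -- THE `L²` CLAUSE = row (Γ5-D) at `V′`, read on `Q_s ⊆ Q`
    have hvgood' : ∀ y, Real.sqrt (1 - κ) ≤ ‖a y‖ → v y = ‖a y‖⁻¹ • a y := by
      intro y hy; rw [← hr] at hy; exact hvgood y hy
    have h := hRD R hRD' a ha v hv1 hvgood'
    have hQs : MeasurableSet {x : EuclideanSpace ℝ (Fin 3) | ∀ i : Fin 3, |x i| < s} := (isOpen_absCube s).measurableSet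
    rw [setIntegral_congr_fun hQs (fun x hx => by
      show ‖v (fun i => ⌊(R : ℝ) * x i⌋) - V x‖ ^ 2 = ‖v (fun i => ⌊(R : ℝ) * x i⌋) - V' x‖ ^ 2
      rw [hVeq (fun i => lt_trans (hx i) hs1)])]
    exact h

end Summit.QuantumFields.YangMills.Theorems.PoincareLipschitzSobolevSamplingConsistency

end
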